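import Summits.QuantumFields.YangMills.Theorems.BalabanUVNodesN15CovariantLandauTwoGridLocal
import Summits.QuantumFields.YangMills.Theorems.BalabanUVNodesN15BackgroundV1Coefficients
import HarnessLib

/-!
# Route «BalabanUVNodes», node N15 = NE2, road (c) — PROGRAMME (P-S), XXXIX: TWO OF THE OSCILLATION LETTERS OF n15-c∕237∕240–243 REDUCED TO THE BASIC ONES — `ω_Ñ ≤ ω_N + nλ` (the back-shifted
# transposed multiplier: King's pairing dichotomy `pr(x′ − e′_μ) ∈ {pr x′, pr x′ − e_μ}`) and `ω_m ≤ (d+1)(ω_Ñ·n′ρ′ + nρ·ω_Ñᶜ)` (the quadratic letter `m = Σ_μ ÑÑᵀ`) (dag-n15-c g24, n15-c∕246)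

Cell `pub-ymgap`, seat `pub-ymgap-dag-n15-c` (generation g24; R134 (a), s1; HUMAN RULING D-0062; chair R424 venue).  `bears_on: R4∕N15 · K3⁸ SpineGivenEndpointR13SepCoPHV
(stmt-QuantumFields-27366)`; filed `--supports stmt-QuantumFields-27366 --as helper` — COUNT-NEUTRAL.  Theorems only; 0 `sorry`.  Imports BY NAME dag-n15-c g3 (`kingPr_sub_unitVec`), 181 (`rows_mul_le`), 163 (`rowSum_add_le`).
Nothing in the tree is modified.

* ★ `omegaN_transpose_le`: rows of `Ñ′(x′) − Ñ(pr x′)` (`Ñ_μ(z) = N_μ(z − e_μ)ᵀ`, `N = n(1 − U)`) `≤ ω_Nᶜ + n·λᶜ` from the COLUMN oscillation `ω_Nᶜ` of `N′ − N∘pr` and the column Lipschitz letter `λᶜ` of `U`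
  (`pr(x′ − e′_μ) = pr x′` inside the block, `= pr x′ − e_μ` on its lower face).
* `rows_sum_mul_transpose_sub_le`: the algebra `Σ_μ(A′_μA′_μᵀ − A_μA_μᵀ) = Σ_μ[(A′_μ − A_μ)A′_μᵀ + A_μ(A′_μ − A_μ)ᵀ]` with rows `≤ (d+1)(ω·α′ + α·ωᶜ)`; ★ `omega_m_le`: the letter `ω_m` of 236∕237∕240–243.

HONEST FRAMING ∕ LIMITS.  Letter bookkeeping; MODEL carriers; NOT [Balaban1985BackgroundPropagators] as printed; NE2⁺ NOT PRINTED; N15 of record untouched (DISCHARGED AS CONSUMED, p687738); counts UNMOVED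
(typed 28∕28 · discharged 8∕27).  Restate-immune.
-/

noncomputable section

open scoped BigOperators Matrix
open Finset

namespace Summit.QuantumFields.YangMills.BalabanUVNodes.N15.CovLandau

open Literature.MathematicalPhysics.QuantumFieldTheory.Balaban1983to89
open Literature.MathematicalPhysics.QuantumFieldTheory.Balaban1983to89.B5Prop11Plancherel (Tor fine unitVec)
open Summit.QuantumFields.YangMills.BalabanUVNodes.N15.VectorPiece (kingPr kingPr_sub_unitVec)
open Summit.QuantumFields.YangMills.BalabanUVNodes.N15.CovAvg (rows_mul_le)
open Summit.QuantumFields.YangMills.BalabanUVNodes.N15.BackgroundLayer (rowSum_add_le)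

variable {d : ℕ}

section Letters

variable {ι : Type} [Fintype ι] [DecidableEq ι]

omit [DecidableEq ι] in
/-- ★ rows of `Σ_μ (A′_μA′_μᵀ − A_μA_μᵀ) ≤ (d+1)(ω·α′ + α·ωᶜ)` from rows `ω` and columns `ωᶜ` of `A′_μ − A_μ`, rows `α` of `A_μ` and columns `α′` of `A′_μ` (columns = rows of the transpose). [folklore] -/
theorem rows_sum_mul_transpose_sub_le (A A' : Fin (d + 1) → Matrix ι ι ℝ) {ω ωc α α' : ℝ}
    (hω : ∀ μ i, ∑ j, |(A' μ - A μ) i j| ≤ ω) (hωc : ∀ μ i, ∑ j, |(A' μ - A μ) j i| ≤ ωc) (hα : ∀ μ i, ∑ j, |A μ i j| ≤ α) (hα' : ∀ μ i, ∑ j, |A' μ j i| ≤ α') (i : ι) :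
    ∑ j, |(∑ μ, A' μ * (A' μ)ᵀ - ∑ μ, A μ * (A μ)ᵀ) i j| ≤ ((d : ℝ) + 1) * (ω * α' + α * ωc) := by
  have key : ∑ μ, A' μ * (A' μ)ᵀ - ∑ μ, A μ * (A μ)ᵀ = ∑ μ, ((A' μ - A μ) * (A' μ)ᵀ + A μ * (A' μ - A μ)ᵀ) := by
    rw [← Finset.sum_sub_distrib]
    refine Finset.sum_congr rfl fun μ _ => ?_
    rw [Matrix.transpose_sub, Matrix.sub_mul, Matrix.mul_sub]
    abel
  rw [key]
  have hωc0 : 0 ≤ ωc := le_trans (Finset.sum_nonneg fun j _ => abs_nonneg _) (hωc 0 i)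
  have hα'0 : 0 ≤ α' := le_trans (Finset.sum_nonneg fun j _ => abs_nonneg _) (hα' 0 i)
  calc ∑ j, |(∑ μ, ((A' μ - A μ) * (A' μ)ᵀ + A μ * (A' μ - A μ)ᵀ)) i j|
      = ∑ j, |∑ μ, ((A' μ - A μ) * (A' μ)ᵀ + A μ * (A' μ - A μ)ᵀ) i j| := by simp only [Matrix.sum_apply]
    _ ≤ ∑ j, ∑ μ, |((A' μ - A μ) * (A' μ)ᵀ + A μ * (A' μ - A μ)ᵀ) i j| := Finset.sum_le_sum fun j _ => Finset.abs_sum_le_sum_abs _ _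
    _ = ∑ μ, ∑ j, |((A' μ - A μ) * (A' μ)ᵀ + A μ * (A' μ - A μ)ᵀ) i j| := Finset.sum_comm
    _ ≤ ∑ _μ : Fin (d + 1), (ω * α' + α * ωc) := Finset.sum_le_sum fun μ _ => by
        refine (rowSum_add_le _ _ i).trans (add_le_add ?_ ?_)
        · exact (rows_mul_le _ _ (fun i' => by simpa only [Matrix.transpose_apply] using hα' μ i') i).trans (mul_le_mul_of_nonneg_right (hω μ i) hα'0)
        · exact (rows_mul_le _ _ (fun i' => by simpa only [Matrix.transpose_apply] using hωc μ i') i).trans (mul_le_mul_of_nonneg_right (hα μ i) hωc0)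
    _ = ((d : ℝ) + 1) * (ω * α' + α * ωc) := by
        simp only [Finset.sum_const, Finset.card_univ, Fintype.card_fin, nsmul_eq_mul]
        push_cast
        ring

variable (M : Fin (d + 1) → ℕ) [∀ μ, NeZero (M μ)] (L k m : ℕ) [NeZero L]

/-- ★ **`ω_Ñ ≤ ω_Nᶜ + n·λᶜ`**: the rows of `Ñ′_μ(x′) − Ñ_μ(pr x′)`, `Ñ_μ(z) = (n(1 − U_μ(z − e_μ)))ᵀ`, from the COLUMN oscillation of `N′ − N∘pr` and the column Lipschitz letter of `U` — King's pairing dichotomy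
`pr(x′ − e′_μ) ∈ {pr x′, pr x′ − e_μ}` (`kingPr_sub_unitVec`). [cite: King1986, p.664 (pairing convention «x′ ∈ B^n(x)»)] -/
theorem omegaN_transpose_le (T : Fin (d + 1) → Tor (fine (L ^ k) M) → Matrix ι ι ℝ) (T' : Fin (d + 1) → Tor (fine (L ^ m * L ^ k) M) → Matrix ι ι ℝ) {ωN lamc : ℝ} (hlam0 : 0 ≤ lamc)
    (hωNc : ∀ ν x' i, ∑ j, |((fun ν x => (((L ^ m * L ^ k : ℕ) : ℝ)) • ((1 : Matrix ι ι ℝ) - T' ν x)) ν x' - (fun ν x => (((L ^ k : ℕ) : ℝ)) • ((1 : Matrix ι ι ℝ) - T ν x)) ν (kingPr L k m M x')) j i| ≤ ωN)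
    (hlamc : ∀ μ (z : Tor (fine (L ^ k) M)) i, ∑ j, |(T μ z - T μ (z - unitVec (fine (L ^ k) M) μ)) j i| ≤ lamc) (μ : Fin (d + 1)) (x' : Tor (fine (L ^ m * L ^ k) M)) (i : ι) :
    ∑ j, |((fun μ z => ((((L ^ m * L ^ k : ℕ) : ℝ)) • ((1 : Matrix ι ι ℝ) - T' μ (z - unitVec (fine (L ^ m * L ^ k) M) μ)))ᵀ) μ x' - (fun μ z => ((((L ^ k : ℕ) : ℝ)) • ((1 : Matrix ι ι ℝ) - T μ (z - unitVec (fine (L ^ k) M) μ)))ᵀ) μ (kingPr L k m M x')) i j| ≤ ωN + (((L ^ k : ℕ) : ℝ)) * lamc := by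
  have hR : (0 : ℝ) ≤ (((L ^ k : ℕ) : ℝ)) := Nat.cast_nonneg _
  have hsplit : (fun μ z => ((((L ^ m * L ^ k : ℕ) : ℝ)) • ((1 : Matrix ι ι ℝ) - T' μ (z - unitVec (fine (L ^ m * L ^ k) M) μ)))ᵀ) μ x' - (fun μ z => ((((L ^ k : ℕ) : ℝ)) • ((1 : Matrix ι ι ℝ) - T μ (z - unitVec (fine (L ^ k) M) μ)))ᵀ) μ (kingPr L k m M x')
      = ((fun ν x => (((L ^ m * L ^ k : ℕ) : ℝ)) • ((1 : Matrix ι ι ℝ) - T' ν x)) μ (x' - unitVec (fine (L ^ m * L ^ k) M) μ) - (fun ν x => (((L ^ k : ℕ) : ℝ)) • ((1 : Matrix ι ι ℝ) - T ν x)) μ (kingPr L k m M (x' - unitVec (fine (L ^ m * L ^ k) M) μ)))ᵀ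
        + ((fun ν x => (((L ^ k : ℕ) : ℝ)) • ((1 : Matrix ι ι ℝ) - T ν x)) μ (kingPr L k m M (x' - unitVec (fine (L ^ m * L ^ k) M) μ)) - (fun ν x => (((L ^ k : ℕ) : ℝ)) • ((1 : Matrix ι ι ℝ) - T ν x)) μ (kingPr L k m M x' - unitVec (fine (L ^ k) M) μ))ᵀ := by
    simp only [Matrix.transpose_sub]
    abel
  rw [hsplit]
  refine (rowSum_add_le _ _ i).trans (add_le_add ?_ ?_)
  · simpa only [Matrix.transpose_apply] using hωNc μ (x' - unitVec (fine (L ^ m * L ^ k) M) μ) i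
  · rcases kingPr_sub_unitVec M L k m x' μ with h | h
    · rw [h]
      have hT : (fun ν x => (((L ^ k : ℕ) : ℝ)) • ((1 : Matrix ι ι ℝ) - T ν x)) μ (kingPr L k m M x') - (fun ν x => (((L ^ k : ℕ) : ℝ)) • ((1 : Matrix ι ι ℝ) - T ν x)) μ (kingPr L k m M x' - unitVec (fine (L ^ k) M) μ)
          = -((((L ^ k : ℕ) : ℝ)) • (T μ (kingPr L k m M x') - T μ (kingPr L k m M x' - unitVec (fine (L ^ k) M) μ))) := by
        simp only [smul_sub]
        abel
      rw [hT, Matrix.transpose_neg]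
      calc ∑ j, |(-((((L ^ k : ℕ) : ℝ)) • (T μ (kingPr L k m M x') - T μ (kingPr L k m M x' - unitVec (fine (L ^ k) M) μ)))ᵀ) i j|
          = (((L ^ k : ℕ) : ℝ)) * ∑ j, |(T μ (kingPr L k m M x') - T μ (kingPr L k m M x' - unitVec (fine (L ^ k) M) μ)) j i| := by
            rw [Finset.mul_sum]
            exact Finset.sum_congr rfl fun j _ => by rw [Matrix.neg_apply, abs_neg, Matrix.transpose_apply, Matrix.smul_apply, smul_eq_mul, abs_mul, abs_of_nonneg hR]
        _ ≤ (((L ^ k : ℕ) : ℝ)) * lamc := mul_le_mul_of_nonneg_left (hlamc μ _ i) hR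
    · rw [h, sub_self, Matrix.transpose_zero]
      simp only [Matrix.zero_apply, abs_zero, Finset.sum_const_zero]
      exact mul_nonneg hR hlam0

omit [∀ μ, NeZero (M μ)] [NeZero L] in
/-- ★ **THE LETTER `ω_m`** of n15-c∕236∕237∕240–243: rows of `m′(x′) − m(pr x′)`, `m(z) = Σ_μ N_μ(z − e_μ)ᵀN_μ(z − e_μ) = Σ_μ Ñ_μ(z)Ñ_μ(z)ᵀ`, `≤ (d+1)(ω_Ñ·α′ + α·ω_Ñᶜ)` from the rows `ω_Ñ` and columns `ω_Ñᶜ` of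
`Ñ′ − Ñ∘pr`, the rows `α` of `Ñ∘pr` (= columns of `N`: `nρ`) and the columns `α′` of `Ñ′` (= rows of `N′`: `n′ρ′`). [cite: Balaban1985BackgroundPropagators, Thm 3.14 pp.426–427 (mechanism)] -/
theorem omega_m_le (T : Fin (d + 1) → Tor (fine (L ^ k) M) → Matrix ι ι ℝ) (T' : Fin (d + 1) → Tor (fine (L ^ m * L ^ k) M) → Matrix ι ι ℝ) {ωt ωtc α α' : ℝ}
    (hωt : ∀ μ x' i, ∑ j, |((fun μ z => ((((L ^ m * L ^ k : ℕ) : ℝ)) • ((1 : Matrix ι ι ℝ) - T' μ (z - unitVec (fine (L ^ m * L ^ k) M) μ)))ᵀ) μ x' - (fun μ z => ((((L ^ k : ℕ) : ℝ)) • ((1 : Matrix ι ι ℝ) - T μ (z - unitVec (fine (L ^ k) M) μ)))ᵀ) μ (kingPr L k m M x')) i j| ≤ ωt)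
    (hωtc : ∀ μ x' i, ∑ j, |((fun μ z => ((((L ^ m * L ^ k : ℕ) : ℝ)) • ((1 : Matrix ι ι ℝ) - T' μ (z - unitVec (fine (L ^ m * L ^ k) M) μ)))ᵀ) μ x' - (fun μ z => ((((L ^ k : ℕ) : ℝ)) • ((1 : Matrix ι ι ℝ) - T μ (z - unitVec (fine (L ^ k) M) μ)))ᵀ) μ (kingPr L k m M x')) j i| ≤ ωtc)
    (hα : ∀ μ (z : Tor (fine (L ^ k) M)) i, ∑ j, |(fun μ z => ((((L ^ k : ℕ) : ℝ)) • ((1 : Matrix ι ι ℝ) - T μ (z - unitVec (fine (L ^ k) M) μ)))ᵀ) μ z i j| ≤ α) (hα' : ∀ μ (z' : Tor (fine (L ^ m * L ^ k) M)) i, ∑ j, |(fun μ z => ((((L ^ m * L ^ k : ℕ) : ℝ)) • ((1 : Matrix ι ι ℝ) - T' μ (z - unitVec (fine (L ^ m * L ^ k) M) μ)))ᵀ) μ z' j i| ≤ α') (x' : Tor (fine (L ^ m * L ^ k) M)) (i : ι) :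
    ∑ j, |((fun z => ∑ μ, ((fun ν x => (((L ^ m * L ^ k : ℕ) : ℝ)) • ((1 : Matrix ι ι ℝ) - T' ν x)) μ (z - unitVec (fine (L ^ m * L ^ k) M) μ))ᵀ * (fun ν x => (((L ^ m * L ^ k : ℕ) : ℝ)) • ((1 : Matrix ι ι ℝ) - T' ν x)) μ (z - unitVec (fine (L ^ m * L ^ k) M) μ)) x' - (fun z => ∑ μ, ((fun ν x => (((L ^ k : ℕ) : ℝ)) • ((1 : Matrix ι ι ℝ) - T ν x)) μ (z - unitVec (fine (L ^ k) M) μ))ᵀ * (fun ν x => (((L ^ k : ℕ) : ℝ)) • ((1 : Matrix ι ι ℝ) - T ν x)) μ (z - unitVec (fine (L ^ k) M) μ)) (kingPr L k m M x')) i j| ≤ ((d : ℝ) + 1) * (ωt * α' + α * ωtc) := by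
  have h := rows_sum_mul_transpose_sub_le (fun μ => (fun μ z => ((((L ^ k : ℕ) : ℝ)) • ((1 : Matrix ι ι ℝ) - T μ (z - unitVec (fine (L ^ k) M) μ)))ᵀ) μ (kingPr L k m M x')) (fun μ => (fun μ z => ((((L ^ m * L ^ k : ℕ) : ℝ)) • ((1 : Matrix ι ι ℝ) - T' μ (z - unitVec (fine (L ^ m * L ^ k) M) μ)))ᵀ) μ x') (fun μ => hωt μ x') (fun μ => hωtc μ x') (fun μ => hα μ _) (fun μ => hα' μ x') i
  simpa only [Matrix.transpose_transpose] using h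

end Letters

end Summit.QuantumFields.YangMills.BalabanUVNodes.N15.CovLandau

end
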